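import Literature.AlgebraicGeometry.HodgeTheory.HomComplex
import Literature.AlgebraicGeometry.Modules.TensorSheafHomAdjunction
import Mathlib.Algebra.Homology.HomotopyCategory.KInjective
import Mathlib.Data.Int.Interval
import HarnessLib

/-!
# `𝓗om•(E•, I•)` has injective terms (and is K-injective) for `E•` bounded and `I•` injective

For cochain complexes of `𝒪_X`-modules `E•`, `I•` on a scheme `X`, the internal Hom complex
`𝓗om•(E•, I•) = homComplex X E I` (`HodgeTheory/HomComplex.lean`: degree-`n` term
`∐_{q + i = n} 𝓗om(E^{-i}, I^q)`) has

* **injective terms** as soon as `E•` is bounded (`E• ∈ [a, b]` strictly) and every summand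
  `𝓗om(E^p, I^q)` with `a ≤ p ≤ b` is injective (`HomComplex.injective_X_of_injective_sheafHom`):
  in degree `n` only the finitely many summands with `-i ∈ [a, b]` are non-zero, so the term is a
  FINITE product of injectives (`HomComplex.XIsoPi`; Mathlib: products of injectives are injective);
* hence is **K-injective** when moreover `I•` is bounded below (`HomComplex.isKInjective_of_injective_sheafHom`;
  Mathlib `CochainComplex.isKInjective_of_injective` with the amplitude bound
  `HomComplex.isStrictlyGE`: `𝓗om•(E•, I•) ≥ c - b`).

The hypothesis «`𝓗om(E^p, I^q)` injective» holds when `E^p` is finite locally free and `I^q` is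
injective (`Modules/TensorSheafHomAdjunction.injective_sheafHom_of_isFiniteLocallyFree`: `𝓗om(E^p, –)`
is right adjoint to the mono-preserving `E^p ⊗ –`), whence the main statements
**`HomComplex.injective_X`** and **`HomComplex.isKInjective`**: for `E•` bounded with finite locally
free terms (strictly perfect) and `I•` a bounded-below complex of injective `𝒪_X`-modules,
`𝓗om•(E•, I•)` is a bounded-below complex of injectives, hence K-injective — so that
`Hom_{D(Mod 𝒪_X)}(Q M, Q 𝓗om•(E•, I•)⟦k⟧) = Hom_{K}(M, 𝓗om•(E•, I•)⟦k⟧)` (Mathlib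
`CochainComplex.IsKInjective.Qh_map_bijective`; Spaltenstein: bounded-below complexes of injectives are
K-injective; Hartshorne III.6, proof of Prop. 6.7: `𝓗om(L, –)` preserves injectives for `L` locally
free of finite rank).

Everything is proved; no named facts, no instances. Use (Hodge programme, road №4, crux 26512): brick
(A2′) of the derived-duality price (β3) — `𝓗om•(E•, I•)` is a K-injective model; library only.

## References

* R. Hartshorne, *Algebraic Geometry*, GTM 52 (1977), III.6, proof of Prop. 6.7 (p. 234). [Hartshorne1977]
* N. Spaltenstein, *Resolutions of unbounded complexes*, Compositio Math. 65 (1988), §1. [Spaltenstein1988]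
* C. Weibel, *An introduction to homological algebra* (1994), 2.7.4–2.7.5, 10.4. [Weibel1994]
-/

noncomputable section

open CategoryTheory CategoryTheory.Limits AlgebraicGeometry Opposite

universe u

namespace Literature.AlgebraicGeometry.HodgeTheory

open Literature.AlgebraicGeometry.Modules Literature.AlgebraicGeometry.Motives

variable (X : Scheme.{u})

namespace HomComplex

variable (E I : CochainComplex X.Modules ℤ) (a b : ℤ) (n : ℤ)

/-- The finitely many summands `𝓗om(E^{-i}, I^{n-i})`, `-b ≤ i ≤ -a`, of `𝓗om•(E•, I•)^n` that can be
non-zero when `E• ∈ [a, b]`. [cite: Weibel1994, 2.7.4–2.7.5 (Hom cochain complex)] -/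
abbrev summand (t : Finset.Icc (-b) (-a)) : X.Modules := sheafHom (E.X (-(t : ℤ))) (I.X (n - t))

/-- The component `𝓗om(E^{-i}, I^q) ⟶ 𝓗om(E^{-t}, I^{n-t})` of the comparison: the identity if `i = t`
(then `q = n - t`), zero otherwise. [cite: Weibel1994, 2.7.4–2.7.5 (Hom cochain complex)] -/
def component (q i : ℤ) (h : q + i = n) (t : Finset.Icc (-b) (-a)) :
    sheafHom (E.X (-i)) (I.X q) ⟶ summand X E I a b n t :=
  if hi : i = t then eqToHom (by rw [show q = n - t by lia, hi]) else 0

/-- The diagonal component is the identity. [cite: Weibel1994, 2.7.4–2.7.5 (Hom cochain complex)] -/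
lemma component_self (t : Finset.Icc (-b) (-a)) :
    component X E I a b n (n - t) t (by lia) t = 𝟙 _ := by
  rw [component, dif_pos rfl]
  rfl

/-- Off-diagonal components vanish. [cite: Weibel1994, 2.7.4–2.7.5 (Hom cochain complex)] -/
lemma component_of_ne (q i : ℤ) (h : q + i = n) (t : Finset.Icc (-b) (-a)) (hi : i ≠ t) :
    component X E I a b n q i h t = 0 := by
  rw [component, dif_neg hi]

/-- `𝓗om•(E•, I•)^n ⟶ ∏_{-b ≤ i ≤ -a} 𝓗om(E^{-i}, I^{n-i})`: the identity on the summands in the window,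
zero on the others (which vanish). [cite: Weibel1994, 2.7.4–2.7.5 (Hom cochain complex)] -/
def toPi : (homComplex X E I).X n ⟶ ∏ᶜ summand X E I a b n :=
  Pi.lift fun t => HomologicalComplex.mapBifunctorDesc fun q i h => component X E I a b n q i h t

/-- `∏_{-b ≤ i ≤ -a} 𝓗om(E^{-i}, I^{n-i}) ⟶ 𝓗om•(E•, I•)^n`: the (finite) sum of the summand
inclusions. [cite: Weibel1994, 2.7.4–2.7.5 (Hom cochain complex)] -/
def fromPi : ∏ᶜ summand X E I a b n ⟶ (homComplex X E I).X n :=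
  ∑ t : Finset.Icc (-b) (-a), Pi.π (summand X E I a b n) t ≫ ι X E I (n - t) t n (by lia)

/-- `ι_{q,i} ≫ toPi ≫ π_t` is the component. [cite: Weibel1994, 2.7.4–2.7.5 (Hom cochain complex)] -/
@[reassoc]
lemma ι_toPi_π (q i : ℤ) (h : q + i = n) (t : Finset.Icc (-b) (-a)) :
    ι X E I q i n h ≫ toPi X E I a b n ≫ Pi.π (summand X E I a b n) t =
      component X E I a b n q i h t := by
  rw [toPi, Pi.lift_π]
  exact HomologicalComplex.ι_mapBifunctorDesc (K₁ := I) (K₂ := dualComplex X E)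
    (F := (sheafHomBifunctor X).flip) (c := ComplexShape.up ℤ) (j := n)
    (fun q i h => component X E I a b n q i h t) q i h

/-- Outside the window the summand `𝓗om(E^{-i}, I^q)` is zero. [cite: Weibel1994, 2.7.4–2.7.5 (Hom cochain complex)] -/
lemma isZero_sheafHom_of_not_mem [E.IsStrictlyGE a] [E.IsStrictlyLE b] (q i : ℤ)
    (ht : i ∉ Finset.Icc (-b) (-a)) :
    IsZero (sheafHom (E.X (-i)) (I.X q)) := by
  rw [Finset.mem_Icc, not_and_or, not_le, not_le] at ht
  rcases ht with ht | ht
  · exact isZero_sheafHom_of_isZero (E.isZero_of_isStrictlyLE b (-i) (by lia)) _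
  · exact isZero_sheafHom_of_isZero (E.isZero_of_isStrictlyGE a (-i) (by lia)) _

/-- **`𝓗om•(E•, I•)^n ≅ ∏_{-b ≤ i ≤ -a} 𝓗om(E^{-i}, I^{n-i})`** for `E• ∈ [a, b]`: a degree of the Hom
complex of a bounded `E•` is the finite product of its summands in the window (finite sums are
products in the additive category `Mod(𝒪_X)`). [cite: Weibel1994, 2.7.4–2.7.5 (Hom cochain complex)] -/
def XIsoPi [E.IsStrictlyGE a] [E.IsStrictlyLE b] : (homComplex X E I).X n ≅ ∏ᶜ summand X E I a b n where
  hom := toPi X E I a b n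
  inv := fromPi X E I a b n
  hom_inv_id := by
    refine HomologicalComplex.mapBifunctor.hom_ext fun q i h => ?_
    change ι X E I q i n h ≫ toPi X E I a b n ≫ fromPi X E I a b n = ι X E I q i n h ≫ 𝟙 _
    rw [Category.comp_id, fromPi, Preadditive.comp_sum, Preadditive.comp_sum]
    by_cases ht : i ∈ Finset.Icc (-b) (-a)
    · rw [Finset.sum_eq_single (⟨i, ht⟩ : Finset.Icc (-b) (-a))]
      · rw [ι_toPi_π_assoc]
        have hqi : q + i = n := h
        obtain rfl : q = n - i := by lia
        rw [component_self X E I a b n ⟨i, ht⟩, Category.id_comp]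
      · intro t _ hti
        rw [ι_toPi_π_assoc, component_of_ne X E I a b n q i h t
          (fun hit => hti (Subtype.ext hit.symm)), zero_comp]
      · intro hi
        exact absurd (Finset.mem_univ _) hi
    · exact (isZero_sheafHom_of_not_mem X E I a b q i ht).eq_of_src _ _
  inv_hom_id := by
    refine Pi.hom_ext _ _ fun s => ?_
    rw [Category.id_comp, Category.assoc, fromPi, Preadditive.sum_comp, Finset.sum_eq_single s]
    · rw [Category.assoc, ι_toPi_π, component_self, Category.comp_id]
    · intro t _ hts
      rw [Category.assoc, ι_toPi_π, component_of_ne X E I a b n _ _ _ s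
        (fun hts' => hts (Subtype.ext hts')), comp_zero]
    · intro hs
      exact absurd (Finset.mem_univ _) hs

variable {E I}

/-- **The terms of `𝓗om•(E•, I•)` are injective** when `E• ∈ [a, b]` and the summands
`𝓗om(E^p, I^q)`, `a ≤ p ≤ b`, are injective (a finite biproduct of injectives is injective).
[cite: Hartshorne1977, III.6 (proof of Prop. 6.7)] -/
theorem injective_X_of_injective_sheafHom [E.IsStrictlyGE a] [E.IsStrictlyLE b]
    (h : ∀ (p q : ℤ), a ≤ p → p ≤ b → Injective (sheafHom (E.X p) (I.X q))) (n : ℤ) :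
    Injective ((homComplex X E I).X n) := by
  haveI : ∀ t : Finset.Icc (-b) (-a), Injective (summand X E I a b n t) := fun t =>
    h (-(t : ℤ)) (n - t) (by have := (Finset.mem_Icc.mp t.2).2; lia)
      (by have := (Finset.mem_Icc.mp t.2).1; lia)
  exact Injective.of_iso (XIsoPi X E I a b n).symm inferInstance

/-- **`𝓗om•(E•, I•)` is K-injective** when `E• ∈ [a, b]`, `I•` is (strictly) bounded below and the
summands `𝓗om(E^p, I^q)`, `a ≤ p ≤ b`, are injective: a bounded-below complex of injectives is
K-injective (Spaltenstein; Mathlib `CochainComplex.isKInjective_of_injective`), with the amplitude bound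
`𝓗om•(E•, I•) ≥ c - b`. [cite: Spaltenstein1988, §1 (Prop. 1.5 and Cor. 1.6)] -/
theorem isKInjective_of_injective_sheafHom [E.IsStrictlyGE a] [E.IsStrictlyLE b] (c : ℤ) [I.IsStrictlyGE c]
    (h : ∀ (p q : ℤ), a ≤ p → p ≤ b → Injective (sheafHom (E.X p) (I.X q))) :
    (homComplex X E I).IsKInjective := by
  haveI := isStrictlyGE X E I b c
  haveI : ∀ n, Injective ((homComplex X E I).X n) := injective_X_of_injective_sheafHom X a b h
  exact CochainComplex.isKInjective_of_injective _ (c - b)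

/-- **The terms of `𝓗om•(E•, I•)` are injective** for `E• ∈ [a, b]` with finite locally free terms and
`I•` termwise injective (`𝓗om(E^p, –)` preserves injectives: right adjoint of the mono-preserving
`E^p ⊗ –`, `Modules/TensorSheafHomAdjunction`). [cite: Hartshorne1977, III.6 (proof of Prop. 6.7)] -/
theorem injective_X [E.IsStrictlyGE a] [E.IsStrictlyLE b] (hE : ∀ p, IsFiniteLocallyFree (E.X p))
    (hI : ∀ q, Injective (I.X q)) (n : ℤ) : Injective ((homComplex X E I).X n) :=
  injective_X_of_injective_sheafHom X a b
    (fun p q _ _ => haveI := hI q; injective_sheafHom_of_isFiniteLocallyFree (hE p) (I.X q)) n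

/-- **`𝓗om•(E•, I•)` is K-injective** for `E• ∈ [a, b]` with finite locally free terms (a strictly
perfect complex) and `I•` a (strictly) bounded-below complex of injective `𝒪_X`-modules: it is a
bounded-below complex of injectives. [cite: Spaltenstein1988, §1 (Prop. 1.5 and Cor. 1.6)] -/
theorem isKInjective [E.IsStrictlyGE a] [E.IsStrictlyLE b] (c : ℤ) [I.IsStrictlyGE c]
    (hE : ∀ p, IsFiniteLocallyFree (E.X p)) (hI : ∀ q, Injective (I.X q)) :
    (homComplex X E I).IsKInjective :=
  isKInjective_of_injective_sheafHom X a b c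
    (fun p q _ _ => haveI := hI q; injective_sheafHom_of_isFiniteLocallyFree (hE p) (I.X q))

end HomComplex

end Literature.AlgebraicGeometry.HodgeTheory

end
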